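import Literature.MathematicalPhysics.QuantumLattice.MatrixProductStatesIntersectionProofs
import Literature.MathematicalPhysics.QuantumLattice.MatrixProductStatesAkltParentProofs
import Literature.MathematicalPhysics.QuantumLattice.MatrixProductStatesAkltTransferProofs
import HarnessLib

/-!
# The open AKLT chain: the intersection property at `ℓ = 2` (FNW Example 7)

Trunk **T-QLATTICE**. Sibling proof file of
`Literature/MathematicalPhysics/QuantumLattice/MatrixProductStates.lean` (next to
`MatrixProductStatesIntersectionProofs.lean`, whose generic Fannes–Nachtergaele–Werner
Lemma 5.5 it specialises, and `MatrixProductStatesAkltParentProofs.lean`, whose two-site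
amplitude table `mpsWithBoundary_two_aklt_apply` it uses). Theorems only: no statement or
definition is changed or introduced. Step 2/3 towards `aklt_unique_periodic_holds`
(`SpinChainsAkltUniqueProofs.lean`); also the kernel computation behind `aklt_open_degeneracy`.

* `exists_boundary_three_aklt` — **FNW Example 7**: the intersection property
  `𝒢₃ = 𝒢₂ ⊗ ℂ³ ∩ ℂ³ ⊗ 𝒢₂` of the AKLT tensor (the base case `2 → 3` not covered by Lemma 5.5,
  which needs injectivity at length `ℓ - 1`);
* `exists_boundary_of_twoSiteSlices_aklt` — for every `n ≥ 2`, a vector on `n` spin-`1` sites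
  all of whose nearest-neighbour two-site slices are AKLT amplitudes `ψ_B` (bond spin `≤ 1`) is
  a boundary MPS `σ ↦ tr (X A^{σ₀} ⋯ A^{σ_{n-1}})`: the zero-energy space of the open AKLT chain
  is the four-dimensional space `{ψ_X : X ∈ M₂(ℂ)}` of valence-bond states.

## Source

M. Fannes, B. Nachtergaele, R. F. Werner, *Finitely correlated states on quantum spin chains*,
Comm. Math. Phys. **144** (1992) 443–490 (held: `paper:doi-10-1007-bf02099178`). Example 7,
p. 473: "We show that for our family of models the interaction length `ℓ₀ = 2` and that the
intersection property of Lemma 5.5 holds for `ℓ = 2`. … It follows that the interaction length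
`ℓ₀` of `ω_θ` equals `2`. As mentioned above the intersection property of Lemma 5.5 holds for
`ℓ = 2`, i.e. `𝒢₃ = 𝒢₂ ⊗ ℂ³ ∩ ℂ³ ⊗ 𝒢₂`. By Lemma 5.3 `4 ≥ dim 𝒢₃ ≥ dim 𝒢₂ = 4` and, as
`𝒢₃ ⊂ 𝒢₂ ⊗ ℂ³ ∩ ℂ³ ⊗ 𝒢₂`, it is sufficient to show that `dim (𝒢₂ ⊗ ℂ³ ∩ ℂ³ ⊗ 𝒢₂) ≤ 4`. This
is straightforward to check using the obvious symmetries of `𝒢₂` … It is now clear that any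
positive nearest neighbor interaction `h_θ` with `ker h_θ = 𝒢₂`, will lead to a VBS model having
`ω_θ` as its unique ground state." The AKLT model is the point `cos θ = √(2/3)` of this family
(Example 1, p. 451; §7, pp. 485–486). Lemma 5.5 and its iteration: pp. 468–469 (see
`MatrixProductStatesIntersectionProofs`). The four-dimensionality of the open-chain ground
space is Affleck–Kennedy–Lieb–Tasaki, CMP **115** (1988), §2 (Theorem 1 / Remark 1).

## Proof

`exists_boundary_three_aklt`: with `A⁺ = s σ⁺`, `A⁰ = -t σᶻ`, `A⁻ = -s σ⁻` (`s, t ≠ 0`) and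
boundary data `ψ(a, u, c) = tr (B_c A^a A^u) = tr (C_a A^u A^c)`, the two-site table
`mpsWithBoundary_two_aklt_apply` turns fifteen of these `27` identities into scalar equations
which give `(B₊)₁₀ = (B₊)₁₁ = (B₋)₀₀ = (B₋)₀₁ = 0`, `s (B₀)₁₀ = t (B₊)₀₀`,
`s (B₀)₁₁ = t (B₊)₀₁`, `t (B₋)₁₀ = s (B₀)₀₀`, `t (B₋)₁₁ = s (B₀)₀₁`, i.e. `B_c = A^c X` for
`X = [[-(B₀)₀₀/t, -(B₀)₀₁/t], [(B₊)₀₀/s, (B₊)₀₁/s]]`; hence `ψ(w c) = tr (B_c A^w) =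
tr (X A^w A^c)`. (This is the "straightforward check"; instead of counting dimensions we
exhibit the boundary matrix.) `exists_boundary_of_twoSiteSlices_aklt`: feed
`isInjectiveMPS_akltTensor_two` (`ℓ₀ = 2`), `transferOp_akltTensor_one_holds`
(`Σ_s A^s A^{s†} = 𝟙`) and the base case into `exists_boundary_of_twoSiteSlices`.

## References

* M. Fannes, B. Nachtergaele, R. F. Werner, Comm. Math. Phys. **144** (1992) 443–490,
  doi:10.1007/bf02099178, §5 Lemma 5.5 (pp. 468–469), Example 7 (p. 473), Example 1 (p. 451),
  §7 (pp. 485–486). [FannesNachtergaeleWernerCMP1992]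
* I. Affleck, T. Kennedy, E. H. Lieb, H. Tasaki, Comm. Math. Phys. **115** (1988) 477–528, §2.
  [AKLT1988]
-/

noncomputable section

open Matrix

namespace Literature.MathematicalPhysics.QuantumLattice

section QLattice

/-! ### FNW Example 7: the intersection property of the AKLT tensor at `ℓ = 2` -/

/-- **Fannes–Nachtergaele–Werner, Example 7 (the intersection property
`𝒢₃ = 𝒢₂ ⊗ ℂ³ ∩ ℂ³ ⊗ 𝒢₂` for the AKLT tensor).** For the AKLT tensor `A⁺ = s σ⁺`,
`A⁰ = -t σᶻ`, `A⁻ = -s σ⁻` (`s, t ≠ 0`): if a vector `ψ` on three spin-`1` sites is a two-site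
boundary MPS `ψ_{B_c}` in the first two letters for every frozen third letter `c`, and a
two-site boundary MPS `ψ_{C_a}` in the last two letters for every frozen first letter `a`, then
`ψ = ψ_X` on three sites, with the explicit `X = [[-(B₀)₀₀/t, -(B₀)₀₁/t], [(B₊)₀₀/s, (B₊)₀₁/s]]`:
the `27` identities `tr (B_c A^a A^u) = tr (C_a A^u A^c)`, read off from the two-site amplitude
table (`mpsWithBoundary_two_aklt_apply`), force `B_c = A^c X`. This is the "straightforward
check" `dim (𝒢₂ ⊗ ℂ³ ∩ ℂ³ ⊗ 𝒢₂) ≤ 4` of Fannes–Nachtergaele–Werner, CMP 144 (1992), Example 7,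
p. 473, at the AKLT point of their family `ω_θ` (Example 1, p. 451); it is the base case that
the generic Lemma 5.5 (which needs injectivity at length `ℓ - 1`) does not cover.
[cite: FannesNachtergaeleWernerCMP1992, §5 Example 7 (p. 473)] -/
theorem exists_boundary_three_aklt (s t : ℂ) (hs : s ≠ 0) (ht : t ≠ 0)
    (ψ : (Fin 3 → Fin 3) → ℂ)
    (hB : ∀ c : Fin 3, ∃ B : Matrix (Fin 2) (Fin 2) ℂ, ∀ w : Fin 2 → Fin 3,
      ψ (Fin.snoc w c) =
        mpsWithBoundary 2 (![!![0, s; 0, 0], !![-t, 0; 0, t], !![0, 0; -s, 0]] : MPSTensor 3 2)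
          B w)
    (hC : ∀ a : Fin 3, ∃ C : Matrix (Fin 2) (Fin 2) ℂ, ∀ w : Fin 2 → Fin 3,
      ψ (Fin.cons a w) =
        mpsWithBoundary 2 (![!![0, s; 0, 0], !![-t, 0; 0, t], !![0, 0; -s, 0]] : MPSTensor 3 2)
          C w) :
    ∃ X : Matrix (Fin 2) (Fin 2) ℂ, ∀ w, ψ w =
      mpsWithBoundary 3 (![!![0, s; 0, 0], !![-t, 0; 0, t], !![0, 0; -s, 0]] : MPSTensor 3 2)
        X w := by
  choose B hB using hB
  choose C hC using hC
  -- the identities `tr (B_c A^a A^u) = ψ(a, u, c) = tr (C_a A^u A^c)`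
  have E : ∀ a u c : Fin 3,
      mpsWithBoundary 2 (![!![0, s; 0, 0], !![-t, 0; 0, t], !![0, 0; -s, 0]] : MPSTensor 3 2)
          (B c) ![a, u] =
        mpsWithBoundary 2 (![!![0, s; 0, 0], !![-t, 0; 0, t], !![0, 0; -s, 0]] : MPSTensor 3 2)
          (C a) ![u, c] := by
    intro a u c
    rw [← hB c ![a, u], ← hC a ![u, c]]
    congr 1
    funext i
    fin_cases i <;> rfl
  have e010 := E 0 1 0
  have e001 := E 0 0 1
  have e200 := E 2 0 0
  have e022 := E 0 2 2
  have e122 := E 1 2 2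
  have e011 := E 0 1 1
  have e002 := E 0 0 2
  have e020 := E 0 2 0
  have e201 := E 2 0 1
  have e210 := E 2 1 0
  have e021 := E 0 2 1
  have e012 := E 0 1 2
  have e211 := E 2 1 1
  have e220 := E 2 2 0
  have e202 := E 2 0 2
  simp only [mpsWithBoundary_two_aklt_apply, Matrix.cons_val] at e010 e001 e200 e022 e122 e011 e002
  simp only [mpsWithBoundary_two_aklt_apply, Matrix.cons_val] at e020 e201 e210 e021 e012 e211 e220
  simp only [mpsWithBoundary_two_aklt_apply, Matrix.cons_val] at e202
  have hss : s * s ≠ 0 := mul_ne_zero hs hs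
  have hst : s * t ≠ 0 := mul_ne_zero hs ht
  -- the eight relations forcing `B_c = A^c X`
  have hC010 : C 0 1 0 = 0 :=
    (mul_eq_zero.1 (show s * t * C 0 1 0 = 0 by linear_combination -e001)).resolve_left hst
  have r1 : B 0 1 0 = 0 :=
    (mul_eq_zero.1 (show s * t * B 0 1 0 = 0 by linear_combination e010 - s * t * hC010)).resolve_left
      hst
  have r2 : B 0 1 1 = 0 :=
    (mul_eq_zero.1 (show s * s * B 0 1 1 = 0 by linear_combination -e200)).resolve_left hss
  have r3 : B 2 0 0 = 0 :=
    (mul_eq_zero.1 (show s * s * B 2 0 0 = 0 by linear_combination -e022)).resolve_left hss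
  have r4 : B 2 0 1 = 0 :=
    (mul_eq_zero.1 (show s * t * B 2 0 1 = 0 by linear_combination -e122)).resolve_left hst
  have hC000 : C 0 0 0 = 0 :=
    (mul_eq_zero.1 (show s * s * C 0 0 0 = 0 by linear_combination e002)).resolve_left hss
  have hB000 : B 0 0 0 = C 0 1 1 := mul_left_cancel₀ hss (by linear_combination -e020)
  have r5 : s * B 1 1 0 = t * B 0 0 0 :=
    mul_left_cancel₀ ht (by linear_combination e011 + t * t * hC000 - t * t * hB000)
  have r6 : s * B 1 1 1 = t * B 0 0 1 :=
    mul_left_cancel₀ hs (by linear_combination -e201 - e210)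
  have r7 : t * B 2 1 0 = s * B 1 0 0 :=
    mul_left_cancel₀ hs (by linear_combination e012 + e021)
  have hC211 : C 2 1 1 = 0 :=
    (mul_eq_zero.1 (show s * s * C 2 1 1 = 0 by linear_combination e220)).resolve_left hss
  have hB211 : B 2 1 1 = C 2 0 0 := mul_left_cancel₀ hss (by linear_combination -e202)
  have r8 : t * B 2 1 1 = s * B 1 0 1 :=
    mul_left_cancel₀ ht (by linear_combination -e211 - t * t * hC211 + t * t * hB211)
  -- hence `B_c = A^c X`
  set X : Matrix (Fin 2) (Fin 2) ℂ := !![-B 1 0 0 / t, -B 1 0 1 / t; B 0 0 0 / s, B 0 0 1 / s]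
    with hX
  have hBc : ∀ c : Fin 3, B c =
      (![!![0, s; 0, 0], !![-t, 0; 0, t], !![0, 0; -s, 0]] : MPSTensor 3 2) c * X := by
    intro c
    fin_cases c <;> ext i j <;> fin_cases i <;> fin_cases j <;>
      simp [hX, Matrix.mul_apply, Fin.sum_univ_two, r1, r2, r3, r4] <;> field_simp
    · linear_combination r5
    · linear_combination r6
    · linear_combination r7
    · linear_combination r8
  refine ⟨X, fun w => ?_⟩
  rw [← Fin.snoc_init_self w, hB, mpsWithBoundary, mpsWithBoundary, wordProduct_snoc, hBc,
    Matrix.mul_assoc, trace_mul_comm, Matrix.mul_assoc]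

/-! ### The open AKLT chain -/

/-- **Kernel of the open AKLT chain is the four-dimensional space of valence-bond states.**
For `n ≥ 2`, a vector `ψ` on `n` spin-`1` sites all of whose nearest-neighbour two-site slices
lie in `𝒢₂ = {ψ_B} = ker P₂` (bond spin `≤ 1` on every bond) is a boundary MPS
`ψ(σ) = tr (X A^{σ₀} ⋯ A^{σ_{n-1}})` of the AKLT tensor. Combines the generic induction
`exists_boundary_of_twoSiteSlices` (Fannes–Nachtergaele–Werner Lemma 5.5) with the AKLT data:
injectivity at length `2` (`isInjectiveMPS_akltTensor_two`, interaction length `ℓ₀ = 2`), the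
normalisation `Σ_s A^s (A^s)† = 𝟙` (`transferOp_akltTensor_one_holds`) and the intersection
property at `ℓ = 2` (`exists_boundary_three_aklt`, Example 7). Fannes–Nachtergaele–Werner,
CMP 144 (1992), Lemma 5.5 and Example 7 (p. 473); Affleck–Kennedy–Lieb–Tasaki, CMP 115
(1988), Thm 1 / §2 (the open chain has exactly the four valence-bond ground states).
[cite: FannesNachtergaeleWernerCMP1992, §5 Lemma 5.5 and Example 7 (p. 473)] -/
theorem exists_boundary_of_twoSiteSlices_aklt (n : ℕ) (hn : 2 ≤ n) (ψ : (Fin n → Fin 3) → ℂ)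
    (hψ : ∀ (j : ℕ) (hj : j + 2 ≤ n) (σ : Fin n → Fin 3),
      ∃ B : Matrix (Fin 2) (Fin 2) ℂ, ∀ τ : Fin n → Fin 3,
        (∀ i : Fin n, i.val ≠ j → i.val ≠ j + 1 → σ i = τ i) →
          ψ τ = mpsWithBoundary 2 akltTensor B (fun i : Fin 2 => τ ⟨j + i, by omega⟩)) :
    ∃ X : Matrix (Fin 2) (Fin 2) ℂ, ∀ w, ψ w = mpsWithBoundary n akltTensor X w := by
  obtain ⟨s, t, hs, ht, hA⟩ := akltTensor_eq_of_sq
  have hs0 : s ≠ 0 := by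
    rintro rfl
    norm_num at hs
  have ht0 : t ≠ 0 := by
    rintro rfl
    norm_num at ht
  have hnorm : ∑ i : Fin 3, akltTensor i * (akltTensor i)ᴴ = 1 := by
    have h := transferOp_akltTensor_one_holds
    rw [transferOp_akltTensor_one, transferOp_apply] at h
    simpa only [Matrix.mul_one] using h
  refine exists_boundary_of_twoSiteSlices isInjectiveMPS_akltTensor_two hnorm
    (fun φ hB hC => ?_) n hn ψ hψ
  rw [hA] at hB hC ⊢
  exact exists_boundary_three_aklt s t hs0 ht0 φ hB hC

end QLattice

end Literature.MathematicalPhysics.QuantumLattice
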